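import Summits.BirchSwinnertonDyer.Rank1Residual.X11b.PadicComplexTransport
import Literature.NumberTheory.EllipticCurves.AnticyclotomicRankinSelbergPAdicLFunction
import Literature.NumberTheory.LFunctions.DworkRationalityLiftingTraceProofs
import Mathlib.FieldTheory.KrullTopology
import HarnessLib

/-!
# X11b @ `p = 3`, S29 K4 infrastructure: the continuous action of `Gal(ℚ̄_p/ℚ_p)` on `ℂ_p` and on
# integral power series (every `p`)

HONEST FRAMING (cell `b2b-bsdres`, run/shared/lean/b2b/bsd-rank1-residual/, verbatim in every
file): the goal of the cell is to DELETE the COMBINATION-SHAPED residual classes of the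
Birch–Swinnerton-Dyer formula for ALL analytic-rank `≤ 1` elliptic curves over `ℚ` — assembled
STRICTLY from published theorems — so that the rank-`≤ 1` remainder becomes exactly the
CONSTRUCTION-SHAPED classes, which are TYPED, NOT attempted. This is not "finishing BSD". Team N8/O2
(X11b at `3`); deal S29 (x11b3-lead GEN 8, OWNERS R9-8/R9-14/R9-21), package K4 (infrastructure),
seat `b2b-bsdres-x11b3-p7` (gen. 5). WORDING OF RECORD (H45, R9-8): S29 RE-EXPRESSES (t) ⟸ (VR);
this file is unconditional `p`-adic bookkeeping and SUPPLIES NOTHING of the class record; the node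
`Three.HsiehDescentAt₃` is UNCHANGED; O2 OPEN / N8 CONSTRUCTION; nothing booked. THEOREMS ONLY (no
definition, no named fact, no `sorry`).

## What this file proves (folklore `p`-adic analysis; plan `s25/K4-PLAN.md` (G1), r2's (T′) input T4)

For `τ ∈ Gal(ℚ̄_p/ℚ_p) = (PadicAlgCl p ≃ₐ[ℚ_[p]] PadicAlgCl p)` (an ISOMETRY of `ℚ̄_p`: tree
`Dwork.norm_algEquiv_apply`, x11b3-p1's `PadicComplexTransport.continuous_algEquiv`, both IMPORTED):
* `exists_continuous_extension` — `τ` EXTENDS to a continuous ring endomorphism `τ̂` of `ℂ_p`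
  (`UniformSpace.Completion.mapRingHom`; unique by x11b3-p1's `ringHom_padicComplex_ext`);
  `norm_extension` — `τ̂` is an isometry; `extension_mul` — `(τ₁τ₂)^ = τ̂₁ ∘ τ̂₂`; `extension_one`;
  `extension_bijective`.
* `continuous_orbit` — for fixed `x ∈ ℂ_p` the orbit map `τ ↦ τ̂ x` is continuous for the Krull
  topology (locally constant on `ℚ̄_p`, uniform approximation).
* `norm_extension_coe_le` / `hasValueAt_map_extension` — `τ̂` preserves `𝒪_{ℂ_p}`, and VALUES MOVE:
  `Q(x) = v ⇒ Q^τ(τ̂ x) = τ̂ v` for `Q ∈ 𝒪_{ℂ_p}⟦T⟧` (`IntSeries.HasValueAt`), where `Q^τ` is `Q` with `τ̂`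
  applied coefficientwise.
No statement here is specific to `3`, to a curve, or to the S29 hypotheses.

References: folklore (Cassels, *Local Fields*, Ch. 7; Bosch–Güntzer–Remmert 3.2); [Castella2018] §2.2
for the value currency.
-/

noncomputable section

open scoped Topology
open Filter Literature.NumberTheory.EllipticCurves
open Literature.NumberTheory.LFunctions.Dwork (norm_algEquiv_apply)
open Summit.BirchSwinnertonDyer.Rank1Residual.X11b.PadicComplexTransport (continuous_algEquiv
  ringHom_padicComplex_ext)

namespace Summit.BirchSwinnertonDyer.Rank1Residual.X11b.Three.RangeTransport

variable {p : ℕ} [Fact p.Prime]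

/-! ### §1. The extension `τ̂` to `ℂ_p` -/

/-- **Extension to `ℂ_p`**: every `τ ∈ Gal(ℚ̄_p/ℚ_p)` extends to a continuous ring endomorphism `τ̂`
of the completion `ℂ_p`. [folklore] -/
theorem exists_continuous_extension (τ : PadicAlgCl p ≃ₐ[ℚ_[p]] PadicAlgCl p) :
    ∃ T : ℂ_[p] →+* ℂ_[p], Continuous T ∧ ∀ x : PadicAlgCl p, T x = τ x := by
  refine ⟨UniformSpace.Completion.mapRingHom τ.toRingHom (continuous_algEquiv τ),
    UniformSpace.Completion.continuous_map, fun x ↦ ?_⟩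
  exact UniformSpace.Completion.mapRingHom_coe (continuous_algEquiv τ) x

/-- **`τ̂` is an isometry of `ℂ_p`.** [folklore] -/
theorem norm_extension {τ : PadicAlgCl p ≃ₐ[ℚ_[p]] PadicAlgCl p} {T : ℂ_[p] →+* ℂ_[p]}
    (hT : Continuous T) (hTτ : ∀ x : PadicAlgCl p, T x = τ x) (x : ℂ_[p]) : ‖T x‖ = ‖x‖ := by
  induction x using UniformSpace.Completion.induction_on with
  | hp => exact isClosed_eq (continuous_norm.comp hT) continuous_norm
  | ih a =>
    rw [hTτ, PadicComplex.norm_extends, PadicComplex.norm_extends, norm_algEquiv_apply]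

/-- **Multiplicativity**: the extension of `τ₁ * τ₂` is `τ̂₁ ∘ τ̂₂`. [folklore] -/
theorem extension_mul {τ₁ τ₂ : PadicAlgCl p ≃ₐ[ℚ_[p]] PadicAlgCl p} {T₁ T₂ T : ℂ_[p] →+* ℂ_[p]}
    (hT₁ : Continuous T₁) (hT₁τ : ∀ x : PadicAlgCl p, T₁ x = τ₁ x)
    (hT₂ : Continuous T₂) (hT₂τ : ∀ x : PadicAlgCl p, T₂ x = τ₂ x)
    (hT : Continuous T) (hTτ : ∀ x : PadicAlgCl p, T x = (τ₁ * τ₂) x) : T = T₁.comp T₂ :=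
  ringHom_padicComplex_ext hT (hT₁.comp hT₂) fun x ↦ by
    rw [hTτ, RingHom.comp_apply, hT₂τ, hT₁τ, AlgEquiv.mul_apply]

/-- The extension of `1` is the identity. [folklore] -/
theorem extension_one {T : ℂ_[p] →+* ℂ_[p]} (hT : Continuous T)
    (hTτ : ∀ x : PadicAlgCl p, T x = (1 : PadicAlgCl p ≃ₐ[ℚ_[p]] PadicAlgCl p) x) :
    T = RingHom.id ℂ_[p] :=
  ringHom_padicComplex_ext hT continuous_id fun x ↦ by rw [hTτ]; rfl

/-- **`τ̂` is bijective** (its inverse is the extension of `τ⁻¹`). [folklore] -/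
theorem extension_bijective {τ : PadicAlgCl p ≃ₐ[ℚ_[p]] PadicAlgCl p} {T : ℂ_[p] →+* ℂ_[p]}
    (hT : Continuous T) (hTτ : ∀ x : PadicAlgCl p, T x = τ x) : Function.Bijective T := by
  obtain ⟨S, hS, hSτ⟩ := exists_continuous_extension τ⁻¹
  have hTS : Continuous (T.comp S) := hT.comp hS
  have hST : Continuous (S.comp T) := hS.comp hT
  have h1 : T.comp S = RingHom.id ℂ_[p] := extension_one hTS fun x ↦ by
    rw [RingHom.comp_apply, hSτ, hTτ, ← AlgEquiv.mul_apply, mul_inv_cancel]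
  have h2 : S.comp T = RingHom.id ℂ_[p] := extension_one hST fun x ↦ by
    rw [RingHom.comp_apply, hTτ, hSτ, ← AlgEquiv.mul_apply, inv_mul_cancel]
  refine ⟨fun x y hxy ↦ ?_, fun y ↦ ⟨S y, ?_⟩⟩
  · have := congrArg S hxy
    rwa [← RingHom.comp_apply, ← RingHom.comp_apply, h2] at this
  · rw [← RingHom.comp_apply, h1]; rfl

/-- `τ̂` fixes `ℚ_p` (indeed the image of `ℚ_p` in `ℂ_p`). [folklore] -/
theorem extension_algebraMap {τ : PadicAlgCl p ≃ₐ[ℚ_[p]] PadicAlgCl p} {T : ℂ_[p] →+* ℂ_[p]}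
    (hTτ : ∀ x : PadicAlgCl p, T x = τ x) (q : ℚ_[p]) :
    T ((algebraMap ℚ_[p] (PadicAlgCl p) q : PadicAlgCl p) : ℂ_[p]) =
      ((algebraMap ℚ_[p] (PadicAlgCl p) q : PadicAlgCl p) : ℂ_[p]) := by
  rw [hTτ, AlgEquiv.commutes]

/-! ### §2. Continuity of the orbit map `τ ↦ τ̂ x` -/

/-- On `ℚ̄_p` the orbit map `τ ↦ τ α` is locally constant for the Krull topology. [folklore] -/
theorem isLocallyConstant_apply (α : PadicAlgCl p) :
    IsLocallyConstant fun τ : PadicAlgCl p ≃ₐ[ℚ_[p]] PadicAlgCl p ↦ τ α := by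
  refine (IsLocallyConstant.iff_exists_open _).2 fun τ₀ ↦ ?_
  set E : IntermediateField ℚ_[p] (PadicAlgCl p) := IntermediateField.adjoin ℚ_[p] {α} with hE
  haveI : FiniteDimensional ℚ_[p] E :=
    IntermediateField.adjoin.finiteDimensional (Algebra.IsIntegral.isIntegral α)
  refine ⟨(fun τ ↦ τ₀ * τ) '' (E.fixingSubgroup : Set (PadicAlgCl p ≃ₐ[ℚ_[p]] PadicAlgCl p)),
    ?_, ⟨1, E.fixingSubgroup.one_mem, mul_one τ₀⟩, ?_⟩
  · exact (Homeomorph.mulLeft τ₀).isOpenMap _ (IntermediateField.fixingSubgroup_isOpen E)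
  · rintro _ ⟨τ, hτ, rfl⟩
    have hα : α ∈ E := IntermediateField.subset_adjoin ℚ_[p] {α} (Set.mem_singleton α)
    have : τ α = α := (IntermediateField.mem_fixingSubgroup_iff _ _).1 hτ α hα
    simp [AlgEquiv.mul_apply, this]

/-- **Continuity of the orbit map**: for a family `T τ` of continuous extensions of the `τ` and a
fixed `x ∈ ℂ_p`, `τ ↦ T τ x` is continuous (Krull topology on the source). [folklore] -/
theorem continuous_orbit (T : (PadicAlgCl p ≃ₐ[ℚ_[p]] PadicAlgCl p) → ℂ_[p] →+* ℂ_[p])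
    (hT : ∀ τ, Continuous (T τ)) (hTτ : ∀ τ (x : PadicAlgCl p), T τ x = τ x) (x : ℂ_[p]) :
    Continuous fun τ ↦ T τ x := by
  refine continuous_iff_continuousAt.2 fun τ₀ ↦ Metric.tendsto_nhds.2 fun ε hε ↦ ?_
  -- approximate `x` by an algebraic element
  have hdense : DenseRange ((↑) : PadicAlgCl p → ℂ_[p]) := UniformSpace.Completion.denseRange_coe
  obtain ⟨α, hα⟩ : ∃ α : PadicAlgCl p, ‖x - (α : ℂ_[p])‖ < ε / 3 := by
    obtain ⟨α, hα⟩ := hdense.exists_dist_lt x (by positivity : (0 : ℝ) < ε / 3)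
    exact ⟨α, by rwa [← dist_eq_norm]⟩
  -- the orbit of `α` is locally constant
  obtain ⟨U, hU, hτ₀U, hconst⟩ :=
    (IsLocallyConstant.iff_exists_open _).1 (isLocallyConstant_apply α) τ₀
  filter_upwards [hU.mem_nhds hτ₀U] with τ hτ
  have hτα : τ α = τ₀ α := by rw [hconst τ hτ, hconst τ₀ hτ₀U]
  have h1 : ‖T τ x - T τ (α : ℂ_[p])‖ < ε / 3 := by
    rw [← map_sub, norm_extension (hT τ) (hTτ τ)]; exact hα
  have h2 : T τ (α : ℂ_[p]) = T τ₀ (α : ℂ_[p]) := by rw [hTτ, hTτ, hτα]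
  have h3 : ‖T τ₀ (α : ℂ_[p]) - T τ₀ x‖ < ε / 3 := by
    rw [← map_sub, norm_extension (hT τ₀) (hTτ τ₀), norm_sub_rev]; exact hα
  calc dist (T τ x) (T τ₀ x) = ‖(T τ x - T τ (α : ℂ_[p])) + (T τ₀ (α : ℂ_[p]) - T τ₀ x)‖ := by
        rw [dist_eq_norm, h2]; congr 1; ring
    _ ≤ ‖T τ x - T τ (α : ℂ_[p])‖ + ‖T τ₀ (α : ℂ_[p]) - T τ₀ x‖ := norm_add_le _ _
    _ < ε / 3 + ε / 3 := add_lt_add h1 h3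
    _ ≤ ε := by linarith

/-! ### §4. `τ̂` on `𝒪_{ℂ_p}⟦T⟧`: values move -/

/-- `τ̂` maps the valuation ring `𝒪_{ℂ_p}` into itself. [folklore] -/
theorem extension_mem_padicComplexInt {τ : PadicAlgCl p ≃ₐ[ℚ_[p]] PadicAlgCl p}
    {T : ℂ_[p] →+* ℂ_[p]} (hT : Continuous T) (hTτ : ∀ x : PadicAlgCl p, T x = τ x)
    (x : PadicComplexInt p) : T (x : ℂ_[p]) ∈ PadicComplexInt p := by
  have hx : ‖(x : ℂ_[p])‖ ≤ 1 := Literature.NumberTheory.LFunctions.Dwork.mem_unitBall.1 x.2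
  exact Literature.NumberTheory.LFunctions.Dwork.mem_unitBall.2 ((norm_extension hT hTτ _).le.trans hx)

/-- **Values move**: if `Q(x) = v` then the coefficientwise image `Q^τ` satisfies `Q^τ(τ̂ x) = τ̂ v`.
Here `Q^τ = Q.map φ` for any ring endomorphism `φ` of `𝒪_{ℂ_p}` through which `τ̂` restricts.
[folklore] -/
theorem hasValueAt_map_extension {T : ℂ_[p] →+* ℂ_[p]} (hT : Continuous T)
    {φ : PadicComplexInt p →+* PadicComplexInt p} (hφ : ∀ y : PadicComplexInt p, (φ y : ℂ_[p]) = T y)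
    {Q : PowerSeries (PadicComplexInt p)} {x v : ℂ_[p]} (h : IntSeries.HasValueAt Q x v) :
    IntSeries.HasValueAt (Q.map φ) (T x) (T v) := by
  unfold IntSeries.HasValueAt at h ⊢
  have := h.map T.toAddMonoidHom hT
  simp only [RingHom.toAddMonoidHom_eq_coe, Function.comp_def, AddMonoidHom.coe_coe, map_mul,
    map_pow] at this
  simpa [PowerSeries.coeff_map, hφ] using this

/-- Values at `τ̂`-FIXED points: if `τ̂ x = x` (e.g. `x ∈ ℚ_p`) and `Q(x) = v`, then `Q^τ(x) = τ̂ v`.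
[folklore] -/
theorem hasValueAt_map_extension_of_fixed {T : ℂ_[p] →+* ℂ_[p]} (hT : Continuous T)
    {φ : PadicComplexInt p →+* PadicComplexInt p} (hφ : ∀ y : PadicComplexInt p, (φ y : ℂ_[p]) = T y)
    {Q : PowerSeries (PadicComplexInt p)} {x v : ℂ_[p]} (hx : T x = x)
    (h : IntSeries.HasValueAt Q x v) : IntSeries.HasValueAt (Q.map φ) x (T v) := by
  simpa [hx] using hasValueAt_map_extension hT hφ h

/-- **Existence of the coefficient map**: `τ̂` restricts to a ring endomorphism `φ` of `𝒪_{ℂ_p}`.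
[folklore] -/
theorem exists_restrict_padicComplexInt {τ : PadicAlgCl p ≃ₐ[ℚ_[p]] PadicAlgCl p}
    {T : ℂ_[p] →+* ℂ_[p]} (hT : Continuous T) (hTτ : ∀ x : PadicAlgCl p, T x = τ x) :
    ∃ φ : PadicComplexInt p →+* PadicComplexInt p, ∀ y : PadicComplexInt p, (φ y : ℂ_[p]) = T y :=
  ⟨(T.comp (PadicComplexInt p).toSubring.subtype).codRestrict (PadicComplexInt p).toSubring
      fun y ↦ extension_mem_padicComplexInt hT hTτ y,
    fun _ ↦ rfl⟩

/-- A series FIXED coefficientwise by `τ̂` has `τ̂`-invariant values at `τ̂`-fixed points: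
`Q^τ = Q`, `τ̂ x = x`, `Q(x) = v ⇒ τ̂ v = v`. [folklore] -/
theorem extension_value_eq_of_map_eq {T : ℂ_[p] →+* ℂ_[p]} (hT : Continuous T)
    {φ : PadicComplexInt p →+* PadicComplexInt p} (hφ : ∀ y : PadicComplexInt p, (φ y : ℂ_[p]) = T y)
    {Q : PowerSeries (PadicComplexInt p)} (hQ : Q.map φ = Q) {x v : ℂ_[p]} (hx : T x = x)
    (h : IntSeries.HasValueAt Q x v) : T v = v :=
  (hQ ▸ hasValueAt_map_extension_of_fixed hT hφ hx h).unique h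

end Summit.BirchSwinnertonDyer.Rank1Residual.X11b.Three.RangeTransport
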